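import Literature.NumberTheory.EllipticCurves.UnramifiedPrimeTwist
import HarnessLib

/-!
# The Mazur–Rubin twist: `π = σ - 1` on cohomology, and `H¹(K, E[p]) → H¹(K, A[p^∞]) → H¹(K, A)`

Companion to `UnramifiedPrimeTwist` (Mazur–Rubin, *Finding large Selmer rank via an arithmetic
theory of local constants*, Ann. of Math. 166 (2007) = arXiv:math/0512085, numbering of the
latter). There the twist `A_χ(K̄) = PrimeTwist.geomModule W χ` of a Weierstrass curve `W` over `K`
by a degree-`p` character `χ`, its endomorphism `π = σ - 1` (`PrimeTwist.piEnd`, generating the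
prime `𝔓` of `R_L = ℤ[ζ_p]`, MR Thm. 3.4(ii) and proof of Prop. 5.2), and the groups
`Sel_𝔓(A_χ/K) ⊆ H¹(K, E[p])`, `Sel_{𝔓^∞}(A_χ/K) ⊆ H¹(K, A_χ[p^∞])`, `Ш(A_χ/K) ⊆ H¹(K, A_χ)` are
defined. This file supplies the `R_L`-module structure on the cohomological side and the maps
between the three levels, all PROVED (functoriality of Mathlib's `ContinuousCohomology.map`
through the tree's `resH1Hom_comp`, file `SubgroupSelmer`):

* `PrimeTwist.piH1`, `PrimeTwist.piH1Primary`: `π` on `H¹(K, A_χ)` and on `H¹(K, A_χ[p^∞])`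
  (induced by the equivariant `π` on coefficients), respecting the local kernels
  (`piH1_mem_localKer`, `piH1Primary_mem_selmerLocalKerPrimary` — the localisation
  `A_χ(K̄) → A_χ(K̄_v)` intertwines `π`, `locMap_geomPi`), hence `Ш(A_χ/K)` and `Sel_{𝔓^∞}(A_χ/K)`
  (`piH1_mem_sha`, `piH1Primary_mem_selmerGroupPInfty`); the restrictions `PrimeTwist.shaPi`,
  `PrimeTwist.selmerPInftyPi`. With these, `Ш(A_χ/K)[𝔓] = ker shaPi`, `𝔓 Ш = range shaPi`, and
  the `R_L ⊗ ℤ_p`-module `Sel_{p^∞}(A/K)` of MR §6 (`cork_{R_p}`) are available to users.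
* `PrimeTwist.torsionH1ToPrimaryH1 : H¹(K, E[p]) → H¹(K, A_χ[p^∞])` along
  `E[p] = A_χ[𝔓] ⊆ A_χ[p^∞]` (`constEmbPrimary`, MR Prop. 4.1) and
  `PrimeTwist.primaryH1ToH1 : H¹(K, A_χ[p^∞]) → H¹(K, A_χ)`; they carry `Sel_𝔓(A_χ/K)` into
  `Sel_{𝔓^∞}(A_χ/K)` and `Sel_{𝔓^∞}(A_χ/K)` into `Ш(A_χ/K)` (`map_selmerGroup_le`,
  `map_selmerGroupPInfty_le`) — the maps in MR (2.1)–(2.2),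
  `0 → A(K)/𝔓A(K) → Sel_𝔓(A/K) → Ш(A/K)[𝔓] → 0`, `0 → A(K) ⊗ ℚ_p/ℤ_p → Sel_{p^∞} → Ш[p^∞] → 0`.

Not here: the exactness statements themselves (kernels `A(K)/𝔓A(K)`, `A(K) ⊗ ℚ_p/ℤ_p`, images
`Ш[𝔓]`, `Ш[p^∞]`), which are Kummer theory for `A_χ` exactly as for `E`
(`WeierstrassCurve.exists_kummerMap`, `map_torsionH1ToH1_selmerGroup` in `Selmer`).

## References

* B. Mazur, K. Rubin, Ann. of Math. 166 (2007), 579–612; arXiv:math/0512085. [MazurRubin2007]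
-/

noncomputable section

open scoped Classical
open scoped AddSubgroup

universe u

namespace Literature.NumberTheory.EllipticCurves

namespace PrimeTwist

/-! ## Generic complements: `p`-primary restriction, `pushforward` intertwines `σ` and `π` -/

section Generic

variable {p : ℕ}

/-- An endomorphism of an abelian group preserves the `p`-primary part. [folklore] -/
theorem map_mem_primaryComponent {A : Type*} [AddCommGroup A] (f : A →+ A) {x : A}
    (hx : x ∈ AddCommGroup.primaryComponent A p) : f x ∈ AddCommGroup.primaryComponent A p := by
  obtain ⟨k, hk⟩ := hx
  exact ⟨k, by rw [← map_nsmul, hk, map_zero]⟩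

/-- Restriction of an endomorphism to the `p`-primary part `A[p^∞]`. [folklore] -/
def restrictPrimary {A : Type*} [AddCommGroup A] (f : A →+ A) :
    AddCommGroup.primaryComponent A p →+ AddCommGroup.primaryComponent A p :=
  (f.comp (AddCommGroup.primaryComponent A p).subtype).codRestrict _ fun x ↦
    map_mem_primaryComponent (p := p) f x.2

/-- Unfolding `restrictPrimary`. [folklore] -/
@[simp]
theorem coe_restrictPrimary {A : Type*} [AddCommGroup A] (f : A →+ A)
    (x : AddCommGroup.primaryComponent A p) : (restrictPrimary (p := p) f x : A) = f x :=
  rfl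

variable {Γ : Type*} [Group Γ] [Fact p.Prime]
variable (χ : Γ →* Multiplicative (ZMod p)) (M : Type*) [AddCommGroup M]
variable {Γ' : Type*} [Group Γ'] {M' : Type*} [AddCommGroup M'] (φ : Γ' →* Γ) (ψ : M →+ M')

/-- `pushforward` intertwines `σ` (`R_L`-linearity of `A(ψ)`).
[cite: MazurRubin2007, Thm 3.4(ii)] -/
theorem pushforward_shift (f : points χ M) :
    pushforward χ M φ ψ (shift χ M f) = shift (χ.comp φ) M' (pushforward χ M φ ψ f) :=
  rfl

/-- `pushforward` intertwines `π = σ - 1`. [cite: MazurRubin2007, Thm 3.4(ii)] -/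
theorem pushforward_piEnd (f : points χ M) :
    pushforward χ M φ ψ (piEnd χ M f) = piEnd (χ.comp φ) M' (pushforward χ M φ ψ f) := by
  rw [piEnd_apply, piEnd_apply, map_sub, pushforward_shift]

end Generic

/-! ## `π` on `H¹(K, A_χ)` and `H¹(K, A_χ[p^∞])` -/

variable {K : Type u} [Field K] (W : WeierstrassCurve K) {p : ℕ} [Fact p.Prime]
variable (χ : Field.absoluteGaloisGroup K →ₜ* Multiplicative (ZMod p))

/-- `π = σ - 1` on `A_χ(K̄)` (`piEnd` at the coerced character).
[cite: MazurRubin2007, Thm 3.4(ii)] -/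
abbrev geomPi : geomModule W χ →+ geomModule W χ :=
  piEnd (χ : Field.absoluteGaloisGroup K →* Multiplicative (ZMod p)) W.geomPoints

/-- **`π` on `H¹(K, A_χ)`**, induced by the `Γ_K`-equivariant endomorphism `π` of `A_χ(K̄)`
(`H¹` is an `R_L`-module, MR Thm. 3.4(ii), §6). [cite: MazurRubin2007, Thm 3.4(ii)] -/
def piH1 : galH1 W χ →+ galH1 W χ :=
  resH1Hom (ContinuousMonoidHom.id (Field.absoluteGaloisGroup K)) (geomPi W χ) (piEnd_smul _ _)

/-- `π` restricted to `A_χ[p^∞]` is `Γ_K`-equivariant. [folklore] -/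
theorem restrictPrimary_geomPi_smul (γ : Field.absoluteGaloisGroup K) (x : primaryModule W χ) :
    restrictPrimary (p := p) (geomPi W χ) (γ • x) = γ • restrictPrimary (p := p) (geomPi W χ) x :=
  Subtype.ext (by
    rw [coe_restrictPrimary, primaryComponent.coe_smul, primaryComponent.coe_smul,
      coe_restrictPrimary, piEnd_smul])

/-- **`π` on `H¹(K, A_χ[p^∞])`** (so that `Sel_{p^∞}(A_χ/K)` is an `R_L ⊗ ℤ_p`-module, MR §6:
`cork_{R_p} Sel_{p^∞}(A/K)`). [cite: MazurRubin2007, §6] -/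
def piH1Primary : galH1Primary W χ →+ galH1Primary W χ :=
  resH1Hom (ContinuousMonoidHom.id (Field.absoluteGaloisGroup K))
    (restrictPrimary (p := p) (geomPi W χ)) (restrictPrimary_geomPi_smul W χ)

variable (E : Type u) [Field E] [Algebra K E]

/-- `H¹(E, A_χ) = H¹_cont(Γ_E, A_χ(K̄_E))` at a `K`-field `E`. [cite: MazurRubin2007, §2] -/
abbrev localH1 : Type u := discreteH1 (Field.absoluteGaloisGroup E) (localModule W χ E)

/-- `π` on `A_χ(K̄_E)`. [cite: MazurRubin2007, §5] -/
abbrev localPi : localModule W χ E →+ localModule W χ E :=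
  piEnd (localChar χ E) (localPoints W E)

/-- `π` on the local module is `Γ_E`-equivariant. [folklore] -/
theorem localPi_smul (τ : Field.absoluteGaloisGroup E) (f : localModule W χ E) :
    localPi W χ E (τ • f) = τ • localPi W χ E f :=
  piEnd_smul _ _ τ f

/-- The localisation `A_χ(K̄) → A_χ(K̄_E)` intertwines `π`. [folklore] -/
theorem locMap_geomPi (f : geomModule W χ) :
    locMap W χ E (geomPi W χ f) = localPi W χ E (locMap W χ E f) :=
  pushforward_piEnd _ _ _ _ f

/-- **`π` respects the local kernels** `ker (H¹(K, A_χ) → H¹(E, A_χ))`: the square of compatible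
pairs `(Γ_E → Γ_K, locMap)`, `(id, π)`, `(id, π_E)`, `(Γ_E → Γ_K, locMap)` commutes
(`locMap_geomPi`), so `res_E ∘ H¹(π) = H¹(π_E) ∘ res_E` by functoriality. [folklore] -/
theorem piH1_mem_localKer {c : galH1 W χ} (hc : c ∈ localKer W χ E) :
    piH1 W χ c ∈ localKer W χ E := by
  rw [localKer, resKer_eq_ker, AddMonoidHom.mem_ker] at hc ⊢
  have key : (resH1Hom (resGal (K := K) E) (locMap W χ E) (locMap_smul W χ E)).comp (piH1 W χ) =
      (resH1Hom (ContinuousMonoidHom.id (Field.absoluteGaloisGroup E)) (localPi W χ E)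
          (localPi_smul W χ E)).comp
        (resH1Hom (resGal (K := K) E) (locMap W χ E) (locMap_smul W χ E)) := by
    unfold piH1
    rw [resH1Hom_comp, resH1Hom_comp]
    exact resH1Hom_congr (by ext; rfl) (by ext f : 1; exact locMap_geomPi W χ E f) _ _
  have hkey := congrArg (fun F : galH1 W χ →+ localH1 W χ E ↦ F c) key
  simp only [AddMonoidHom.comp_apply] at hkey
  rw [hkey, hc, map_zero]

/-- Equivariance of the `p^∞` localisation `A_χ[p^∞] ⊆ A_χ(K̄) → A_χ(K̄_E)` (the compatibility
term of `selmerLocalKerPrimary`). [folklore] -/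
theorem locMap_primary_smul (τ : Field.absoluteGaloisGroup E) (P : primaryModule W χ) :
    (locMap W χ E).comp (primaryModule W χ).subtype (resGal (K := K) E τ • P) =
      τ • (locMap W χ E).comp (primaryModule W χ).subtype P := by
  change locMap W χ E (((resGal (K := K) E τ • P : ↥(primaryModule W χ)) : geomModule W χ)) =
    τ • locMap W χ E (P : geomModule W χ)
  rw [primaryComponent.coe_smul, locMap_smul]

/-- `selmerLocalKerPrimary` with its compatibility term named (definitional). [folklore] -/
theorem selmerLocalKerPrimary_eq :
    selmerLocalKerPrimary W χ E =
      resKer (resGal (K := K) E) ((locMap W χ E).comp (primaryModule W χ).subtype)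
        (locMap_primary_smul W χ E) :=
  rfl

/-- **`π` respects the `p^∞` local kernels** `ker (H¹(K, A_χ[p^∞]) → H¹(E, A_χ))`. [folklore] -/
theorem piH1Primary_mem_selmerLocalKerPrimary {c : galH1Primary W χ}
    (hc : c ∈ selmerLocalKerPrimary W χ E) :
    piH1Primary W χ c ∈ selmerLocalKerPrimary W χ E := by
  rw [selmerLocalKerPrimary_eq, resKer_eq_ker, AddMonoidHom.mem_ker] at hc ⊢
  have key : (resH1Hom (resGal (K := K) E) ((locMap W χ E).comp (primaryModule W χ).subtype)
      (locMap_primary_smul W χ E)).comp (piH1Primary W χ) =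
      (resH1Hom (ContinuousMonoidHom.id (Field.absoluteGaloisGroup E)) (localPi W χ E)
          (localPi_smul W χ E)).comp
        (resH1Hom (resGal (K := K) E) ((locMap W χ E).comp (primaryModule W χ).subtype)
          (locMap_primary_smul W χ E)) := by
    unfold piH1Primary
    rw [resH1Hom_comp, resH1Hom_comp]
    exact resH1Hom_congr (by ext; rfl)
      (by ext f : 1; exact locMap_geomPi W χ E (f : geomModule W χ)) _ _
  have hkey := congrArg (fun F : galH1Primary W χ →+ localH1 W χ E ↦ F c) key
  simp only [AddMonoidHom.comp_apply] at hkey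
  rw [hkey, hc, map_zero]

/-! ## `H¹(K, E[p]) → H¹(K, A_χ[p^∞]) → H¹(K, A_χ)` -/

/-- `constEmb` lands in the `p`-primary part (`p • constEmb P = constEmb (p • P) = 0`).
[cite: MazurRubin2007, Prop 4.1] -/
theorem constEmb_mem_primaryModule (P : W.geomPoints[(p : ℤ)]) :
    constEmb (χ : Field.absoluteGaloisGroup K →* Multiplicative (ZMod p)) W.geomPoints P ∈
      primaryModule W χ := by
  refine ⟨1, ?_⟩
  rw [pow_one, ← map_nsmul, AddSubgroup.torsionBy.nsmul P, map_zero]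

/-- `E[p] = A_χ[𝔓] ⊆ A_χ[p^∞]` (the constant embedding, co-restricted).
[cite: MazurRubin2007, Prop 4.1] -/
def constEmbPrimary : W.geomPoints[(p : ℤ)] →+ primaryModule W χ :=
  (constEmb (χ : Field.absoluteGaloisGroup K →* Multiplicative (ZMod p)) W.geomPoints).codRestrict
    _ (constEmb_mem_primaryModule W χ)

/-- `constEmbPrimary` is `Γ_K`-equivariant. [cite: MazurRubin2007, Prop 4.1] -/
theorem constEmbPrimary_smul (γ : Field.absoluteGaloisGroup K) (P : W.geomPoints[(p : ℤ)]) :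
    constEmbPrimary W χ (γ • P) = γ • constEmbPrimary W χ P :=
  rfl

/-- **`H¹(K, E[p]) → H¹(K, A_χ[p^∞])`** induced by `E[p] = A_χ[𝔓] ⊆ A_χ[p^∞]` (the map behind
`Sel_𝔓(A/K) → Sel_{p^∞}(A/K)[𝔓]`, MR (2.1)–(2.2), §6). [cite: MazurRubin2007, §2] -/
def torsionH1ToPrimaryH1 : W.galH1Torsion p →+ galH1Primary W χ :=
  resH1Hom (ContinuousMonoidHom.id (Field.absoluteGaloisGroup K)) (constEmbPrimary W χ)
    (constEmbPrimary_smul W χ)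

/-- **`H¹(K, A_χ[p^∞]) → H¹(K, A_χ)`** induced by the inclusion (the map behind
`Sel_{p^∞}(A/K) → Ш(A/K)[p^∞]`, MR (2.2)). [cite: MazurRubin2007, §2] -/
def primaryH1ToH1 : galH1Primary W χ →+ galH1 W χ :=
  resH1Hom (ContinuousMonoidHom.id (Field.absoluteGaloisGroup K)) (primaryModule W χ).subtype
    fun _ _ ↦ rfl

/-- `H¹(K, E[p]) → H¹(K, A_χ[p^∞])` carries the `𝔓`-Selmer local condition into the `p^∞` one
(the composite pair is literally `(Γ_E → Γ_K, locMap ∘ constEmb)`). [folklore] -/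
theorem torsionH1ToPrimaryH1_mem {c : W.galH1Torsion p} (hc : c ∈ selmerLocalKer W χ E) :
    torsionH1ToPrimaryH1 W χ c ∈ selmerLocalKerPrimary W χ E := by
  rw [selmerLocalKerPrimary_eq, resKer_eq_ker, AddMonoidHom.mem_ker, ← AddMonoidHom.comp_apply]
  unfold torsionH1ToPrimaryH1
  rw [resH1Hom_comp]
  exact hc

/-- `H¹(K, A_χ[p^∞]) → H¹(K, A_χ)` carries the `p^∞` local condition into the local kernel.
[folklore] -/
theorem primaryH1ToH1_mem {c : galH1Primary W χ} (hc : c ∈ selmerLocalKerPrimary W χ E) :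
    primaryH1ToH1 W χ c ∈ localKer W χ E := by
  rw [localKer, resKer_eq_ker, AddMonoidHom.mem_ker, ← AddMonoidHom.comp_apply]
  unfold primaryH1ToH1
  rw [resH1Hom_comp]
  exact hc

/-! ## Over a number field: `Ш(A_χ/K)` and `Sel_{𝔓^∞}(A_χ/K)` as `R_L`-modules -/

section NumberField

open NumberField IsDedekindDomain

variable [NumberField K]

/-- **`π` preserves `Ш(A_χ/K)`** (`Ш` is an `R_L`-module; MR §6, App. A).
[cite: MazurRubin2007, §6] -/
theorem piH1_mem_sha {c : galH1 W χ} (hc : c ∈ sha W χ) : piH1 W χ c ∈ sha W χ := by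
  rw [mem_sha_iff] at hc ⊢
  exact ⟨fun v ↦ piH1_mem_localKer W χ _ (hc.1 v), fun w ↦ piH1_mem_localKer W χ _ (hc.2 w)⟩

/-- **`π` on `Ш(A_χ/K)`**; `Ш(A_χ/K)[𝔓] = ker`, `𝔓 Ш(A_χ/K) = range`. [cite: MazurRubin2007, §6] -/
def shaPi : sha W χ →+ sha W χ :=
  ((piH1 W χ).comp (sha W χ).subtype).codRestrict _ fun c ↦ piH1_mem_sha W χ c.2

/-- Unfolding `shaPi`. [cite: MazurRubin2007, §6] -/
@[simp]
theorem coe_shaPi (c : sha W χ) : (shaPi W χ c : galH1 W χ) = piH1 W χ c := rfl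

/-- **`π` preserves `Sel_{𝔓^∞}(A_χ/K)`** (an `R_L ⊗ ℤ_p`-module, MR §6).
[cite: MazurRubin2007, §6] -/
theorem piH1Primary_mem_selmerGroupPInfty {c : galH1Primary W χ}
    (hc : c ∈ selmerGroupPInfty W χ) : piH1Primary W χ c ∈ selmerGroupPInfty W χ := by
  simp only [selmerGroupPInfty, AddSubgroup.mem_inf, AddSubgroup.mem_iInf] at hc ⊢
  exact ⟨fun v ↦ piH1Primary_mem_selmerLocalKerPrimary W χ _ (hc.1 v),
    fun w ↦ piH1Primary_mem_selmerLocalKerPrimary W χ _ (hc.2 w)⟩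

/-- **`π` on `Sel_{𝔓^∞}(A_χ/K)`**. [cite: MazurRubin2007, §6] -/
def selmerPInftyPi : selmerGroupPInfty W χ →+ selmerGroupPInfty W χ :=
  ((piH1Primary W χ).comp (selmerGroupPInfty W χ).subtype).codRestrict _ fun c ↦
    piH1Primary_mem_selmerGroupPInfty W χ c.2

/-- Unfolding `selmerPInftyPi`. [cite: MazurRubin2007, §6] -/
@[simp]
theorem coe_selmerPInftyPi (c : selmerGroupPInfty W χ) :
    (selmerPInftyPi W χ c : galH1Primary W χ) = piH1Primary W χ c :=
  rfl

/-- **`Sel_𝔓(A_χ/K) → Sel_{𝔓^∞}(A_χ/K)`**: the image of the `𝔓`-Selmer group under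
`H¹(K, E[p]) → H¹(K, A_χ[p^∞])` lies in the `𝔓^∞`-Selmer group (MR (2.1)–(2.2)).
[cite: MazurRubin2007, §2] -/
theorem map_selmerGroup_le :
    (selmerGroup W χ).map (torsionH1ToPrimaryH1 W χ) ≤ selmerGroupPInfty W χ := by
  rintro _ ⟨c, hc, rfl⟩
  rw [SetLike.mem_coe, mem_selmerGroup_iff] at hc
  simp only [selmerGroupPInfty, AddSubgroup.mem_inf, AddSubgroup.mem_iInf]
  exact ⟨fun v ↦ torsionH1ToPrimaryH1_mem W χ _ (hc.1 v),
    fun w ↦ torsionH1ToPrimaryH1_mem W χ _ (hc.2 w)⟩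

/-- **`Sel_{𝔓^∞}(A_χ/K) → Ш(A_χ/K)`**: the image of the `𝔓^∞`-Selmer group under
`H¹(K, A_χ[p^∞]) → H¹(K, A_χ)` lies in `Ш(A_χ/K)` (MR (2.2)). [cite: MazurRubin2007, §2] -/
theorem map_selmerGroupPInfty_le :
    (selmerGroupPInfty W χ).map (primaryH1ToH1 W χ) ≤ sha W χ := by
  rintro _ ⟨c, hc, rfl⟩
  simp only [selmerGroupPInfty, AddSubgroup.coe_inf, AddSubgroup.coe_iInf, Set.mem_inter_iff,
    Set.mem_iInter, SetLike.mem_coe] at hc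
  rw [mem_sha_iff]
  exact ⟨fun v ↦ primaryH1ToH1_mem W χ _ (hc.1 v), fun w ↦ primaryH1ToH1_mem W χ _ (hc.2 w)⟩

end NumberField

end PrimeTwist

/-! ## Dot notation on `UnramifiedPrimeTwist` -/

namespace UnramifiedPrimeTwist

variable {K : Type u} [Field K] [NumberField K] {p : ℕ} [Fact p.Prime]
variable (T : UnramifiedPrimeTwist K p) (W : WeierstrassCurve K)

/-- `π` on `Ш(A_L/K)` for the unramified twist. [cite: MazurRubin2007, §6] -/
abbrev shaPi : T.sha W →+ T.sha W := PrimeTwist.shaPi W T.char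

/-- `π` on `Ш(A_L/K)[𝔓^∞] = Ш(A_L/K)[p^∞]` (the finite `R_L ⊗ ℤ_p`-module `M` of the Cassels–Tate
arguments of MR §6 / App. A when `Ш[p^∞]` is finite). [cite: MazurRubin2007, §6] -/
abbrev shaPrimaryPi : T.shaPrimary W →+ T.shaPrimary W :=
  PrimeTwist.restrictPrimary (p := p) (T.shaPi W)

/-- `Ш(A_L/K)[𝔓]`, the `𝔓`-torsion of `Ш` (kernel of `π`). [cite: MazurRubin2007, §6] -/
abbrev shaPTorsion : AddSubgroup ↥(T.sha W) := (T.shaPi W).ker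

/-- `π` on `Sel_{𝔓^∞}(A_L/K)`. [cite: MazurRubin2007, §6] -/
abbrev selmerPInftyPi : T.selmerGroupPInfty W →+ T.selmerGroupPInfty W :=
  PrimeTwist.selmerPInftyPi W T.char

end UnramifiedPrimeTwist

end Literature.NumberTheory.EllipticCurves
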